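import Literature.AlgebraicGeometry.HodgeTheory.WeilClassesFieldSubfield
import Literature.AlgebraicGeometry.HodgeTheory.WeilClassesFieldSubfieldAlgebraic
import HarnessLib

/-!
# Weil classes of a SUBFIELD `F = ℚ(S(φ)) ⊆ F′ = ℚ(φ)`, IV: `W_F ⊗ ℂ` lies in every cup-product-closed
# system of classes containing `W_{F′} ⊗ ℂ` — ANY index `[F′:F]` (Moonen–Zarhin 1998, Remark (1))

Layer `Literature/AlgebraicGeometry/HodgeTheory`, theorem-only sequel of `WeilClassesFieldSubfield`
(multiplicities add along the fibres of `Σ_{F′} → Σ_F`; `|fibre| · r = r′`), `WeilClassesFieldSubfieldExteriorProducts`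
(the `W_F`-line above `μ` is the cup product of the two `W_{F′}`-lines above a TWO-element fibre) and
`WeilClassesFieldSubfieldAlgebraic` (`W_{F′} ⊗ ℂ` algebraic ⟹ `W_F ⊗ ℂ` algebraic for `[F′:F] = 2`).  THIS file removes
the index-two restriction: the fibres of `Σ_{F′} → Σ_F` may have any number of elements.

PRINTED STATEMENT.  B. J. J. Moonen – Yu. G. Zarhin, *Weil classes on abelian varieties*, J. reine angew. Math. 496
(1998) 83–92 = arXiv:alg-geom/9612017 (held text `paper:arxiv-alg-geom_9612017`), section «In practice, the condition
…», Remark **(1)** (chunk p0004, lines 66–76): «Furthermore, if `F ⊆ F′` then we have the implication `W_{F′}` consists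
of decomposable Hodge classes ⟹ `W_F` consists of decomposable Hodge classes.  This is a direct consequence of
Criterion (crit2).  It can also be seen more directly, by using that **`W_F` is contained in the vector subspace
generated by exterior products of elements of `W_{F′}`**.»  With the Introduction (chunk p0001):
«`W_F ⊗ ℂ = (⋀^r_F V_X) ⊗ ℂ = ⊕_{σ ∈ Σ_F} ⋀^r_ℂ V_{ℂ,σ}`», the mechanism is: for `τ ∈ Σ_F`,
`V_{ℂ,τ} = ⊕_{τ′|τ} V_{ℂ,τ′}`, so `⋀^{r_F} V_{ℂ,τ} = ⊗_{τ′|τ} ⋀^{r_{F′}} V_{ℂ,τ′}` (`r_F = [F′:F] · r_{F′}`): the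
`W_F`-line above `τ` is the exterior (cup) product of the `[F′:F]` `W_{F′}`-lines above it.  Hence `W_F ⊗ ℂ` lies
in every subspace system of `H^{2•}` closed under cup products that contains `W_{F′} ⊗ ℂ` — Moonen–Zarhin's `D`
(decomposable classes), the Hodge classes, the algebraic classes (C. Voisin, *Hodge Theory and Complex Algebraic
Geometry II*, Prop. 9.20: `cl(Z · Z′) = cl(Z) ∪ cl(Z′)`, proved in the tree on abelian varieties as
`AbelianVariety.cupProduct_mem_algebraicClasses'`).

WHAT IS PROVED (theorems only; no definition, no named fact).  Data: `φ : A ⟶ A` with `P(φ) = 0` in `End A`,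
`P ∈ ℤ[T]` monic irreducible over `ℚ` of degree `e`, `e · r = 2 dim A` (`F′ = ℚ(φ)`, `W_{F′} ⊗ ℂ = weilClassesField A φ P r`);
`ψ : A ⟶ A` with `ψ = S(φ)` in `End A` (`S ∈ ℤ[T]` arbitrary) and `Q(ψ) = 0`, `Q ∈ ℤ[T]` monic irreducible of degree
`e′`, `e′ · r′ = 2 dim A` (`F = ℚ(ψ) ⊆ F′`, `W_F ⊗ ℂ = weilClassesField A ψ Q r′`; then every fibre of `ρ ↦ S(ρ)` on the
roots has `r′/r = [F′:F]` elements, `card_fibre_mul_eq_of_eq_eval₂`).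
* §1 **`exists_pullbackEigenclasses_eq_span_cupPowOne_of_eq_eval₂`** — THE `W_F`-LINE ABOVE `μ` IS A WEDGE OF
  `φ`-EIGENVECTORS FROM THE FIBRE: for every complex root `μ` of `Q` there is a linearly independent family
  `w : Fin r′ → H¹(A(ℂ); ℂ)`, each `w_t` a `φ^*`-eigenvector with eigenvalue a root `ρ_t` of `P` above `μ`
  (`S(ρ_t) = μ`) — the concatenation of bases of the `V_ρ(φ)`, `ρ` in the fibre — with
  `pullbackEigenclasses A ψ r′ ((x + yμ)^{r′}) = ℂ · (w₀ ⌣ ⋯ ⌣ w_{r′-1})` (the iterated cup product of the top wedges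
  of the `[F′:F]` blocks: `⋀^{r_F} V_{ℂ,τ} = ⊗_{τ′|τ} ⋀^{r_{F′}} V_{ℂ,τ′}`).
* §2 **`weilClassesField_le_of_cupProduct_mem_of_eq_eval₂`** — MOONEN–ZARHIN'S SENTENCE FOR ANY INDEX, on the
  carriers: for every system `M n ⊆ Hⁿ(A(ℂ); ℂ)` (`n ∈ ℕ`) of subspaces closed under cup products and containing
  `1 ∈ H⁰`: `weilClassesField A φ P r ⊆ M r ⟹ weilClassesField A ψ Q r′ ⊆ M r′`.
* §3 **`weilClassesField_le_of_cupProduct_mem_even_of_eq_eval₂`** — the same for a system `N j ⊆ H^{2j}` of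
  even-degree subspaces closed under cup products with `N 0 = H⁰` (the shape of the tree's `algebraicClasses A.X`):
  `weilClassesField A φ P (2m) ⊆ N m ⟹ weilClassesField A ψ Q (2m′) ⊆ N m′` (§2 applied to the system equal to `N j`
  in degree `2j` and to `0` in odd degrees).
* §4 **`weilClassesField_le_algebraicClasses_of_eq_eval₂_of_irreducible`** — `W_{F′} ⊗ ℂ` ALGEBRAIC ⟹ `W_F ⊗ ℂ`
  ALGEBRAIC for a subfield `F ⊆ F′` of ANY index (Voisin II Prop. 9.20 on `A`);
  `weilClassesField_le_algebraicClasses_of_isRationalClass_of_irreducible` — ONE non-zero rational algebraic class of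
  `W_{F′} ⊗ ℂ` (`m > 0`) makes `W_F ⊗ ℂ` algebraic for every subfield `F = ℚ(S(φ))` (one-class lemma
  `weilClassesField_le_algebraicClasses_of_isRationalClass_of_ne_zero`, Moonen–Zarhin «`dim_F W_F = 1`» / Markman §4);
  `weilClassesField_le_algebraicClasses_of_isWeilTypeCM_of_eq_eval₂` — for Deligne's Weil-type CM data
  `Deligne1982.IsWeilTypeCM A η R e₀ k` (`E = ℚ(η)`, `W_E ⊗ ℂ = weilClassesField A η (R(T²)) (2k)`) and ANY subfield
  `ℚ(S(η)) ⊆ E` cut out by a monic irreducible `Q` with `Q(S(η)) = 0`: `W_E ⊗ ℂ` algebraic ⟹ `W_{ℚ(S(η))} ⊗ ℂ` algebraic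
  (the case `S = T²`, `E₀ ⊂ E`, is `WeilClassesFieldSubfieldAlgebraic` §5).

Not treated here: Moonen–Zarhin's algebra `D` of decomposable classes itself (no carrier in the tree; §2/§3 apply to
it once it is a cup-product-closed system `M`); the converse of Remark (1) for `F′ ⊇ E` (Hodge-group side).

No `sorry`; axioms `propext`, `Classical.choice`, `Quot.sound`.

## References
* [MoonenZarhin1998WeilClasses] B. J. J. Moonen, Yu. G. Zarhin, *Weil classes on abelian varieties*, J. reine angew.
  Math. 496 (1998) 83–92 = arXiv:alg-geom/9612017: Introduction (`W_F ⊗ ℂ = ⊕_σ ⋀^r V_{ℂ,σ}`, `dim_F W_F = 1`; chunk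
  p0001) and section «In practice…», Remark (1), last sentence (chunk p0004).
* [Deligne1982HodgeCycles] P. Deligne (notes by J. S. Milne), *Hodge cycles on abelian varieties*, LNM 900 (1982), §4
  (4.3)–(4.4) (PDF p. 46: `H¹_B ⊗ ℂ = ⊕_σ H¹_{B,σ}`, `⋀^d_{E ⊗ ℂ} = ⊕_σ ⋀^d H¹_{B,σ}`), §5 Prop. 5.1.
* [VoisinHodgeII2003] C. Voisin, *Hodge Theory and Complex Algebraic Geometry II* (2003), Prop. 9.20.
* [Markman2025SurveySecant] E. Markman, arXiv:2509.23403, §4 (one algebraic class on the `K`-line suffices).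
* [LangeBirkenhake1992] H. Lange, Ch. Birkenhake, *Complex Abelian Varieties* (1992), Lemma 1.1.17 (`H• = ⋀• H¹`).
* [HatcherAT2002] A. Hatcher, *Algebraic Topology* (2002), §3.2 Prop. 3.10 and p. 211 (bilinearity, associativity
  and unit of `⌣`).
-/

noncomputable section

open CategoryTheory Polynomial

namespace Literature.AlgebraicGeometry.HodgeTheory

section HodgeTheory

open Literature.AlgebraicTopology.SingularHomology
open Literature.AlgebraicGeometry.Motives (IsSmoothProjective)

variable {A : Motives.AbelianVariety ℂ} {φ ψ : A ⟶ A} {P S Q : Polynomial ℤ} {e r e' r' : ℕ}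

/-! ### §0 The core induction over a finite set of eigenvalues (private) -/

section Core

/-- Core induction (the mechanism `⋀^{r_F} V_{ℂ,τ} = ⊗_{τ′|τ} ⋀^{r_{F′}} V_{ℂ,τ′}` of Moonen–Zarhin's Remark (1)):
for a finite set `T` of complex numbers at each of which `dim V_ρ(φ) = r` and the line `⋀ʳ V_ρ(φ)` lies in a
cup-product-closed system `M ∋ 1`, the concatenation `w` of bases of the `V_ρ(φ)`, `ρ ∈ T`, is linearly
independent and its top wedge `w₀ ⌣ ⋯ ⌣ w_{n-1}` (`n = |T| · r`) lies in `M`.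
[cite: MoonenZarhin1998WeilClasses, Remark (1), last sentence (chunk p0004)] -/
private theorem exists_cupPowOne_mem_of_lines_le (M : (n : ℕ) → Submodule ℂ (complexBetti A.X n))
    (hM : ∀ {k l n : ℕ} (h : k + l = n) {a : complexBetti A.X k} {b : complexBetti A.X l},
      a ∈ M k → b ∈ M l → cupProduct h a b ∈ M n)
    (h₁ : singularCohomology.one ℂ (Motives.ComplexPoints A.X) ∈ M 0) (T : Finset ℂ)
    (hdim : ∀ ρ ∈ T,
      Module.finrank ℂ ↥(Module.End.eigenspace (complexBetti.map φ.hom.hom.hom 1).hom ρ) = r)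
    (hline : ∀ ρ ∈ T, pullbackEigenclasses A φ r (fun x y => ((x : ℂ) + (y : ℂ) * ρ) ^ r) ≤ M r) :
    ∃ (n : ℕ) (w : Fin n → complexBetti A.X 1), n = T.card * r ∧ LinearIndependent ℂ w ∧
      (∀ t, ∃ ρ ∈ T, w t ∈ Module.End.eigenspace (complexBetti.map φ.hom.hom.hom 1).hom ρ) ∧
      cupPowOne ℂ (Motives.ComplexPoints A.X) n w ∈ M n := by
  classical
  haveI := finite_complexBetti_abelianVariety A 1
  induction T using Finset.induction_on with
  | empty =>
    refine ⟨0, Fin.elim0, by simp, linearIndependent_empty_type, fun t => t.elim0, ?_⟩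
    rw [cupPowOne_zero]
    exact h₁
  | insert ρ T hρT ih =>
    obtain ⟨n₀, w₀, hn₀, hli₀, hmem₀, hM₀⟩ :=
      ih (fun ρ' hρ' => hdim ρ' (Finset.mem_insert_of_mem hρ'))
        (fun ρ' hρ' => hline ρ' (Finset.mem_insert_of_mem hρ'))
    -- a basis `u` of `V_ρ(φ)`, read in `H¹`
    let u : Module.Basis (Fin r) ℂ ↥(Module.End.eigenspace (complexBetti.map φ.hom.hom.hom 1).hom ρ) :=
      (Module.finBasis ℂ _).reindex (finCongr (hdim ρ (Finset.mem_insert_self ρ T)))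
    have hu : ∀ i, (u i : complexBetti A.X 1) ∈
        Module.End.eigenspace (complexBetti.map φ.hom.hom.hom 1).hom ρ := fun i => (u i).2
    have hli_u : LinearIndependent ℂ (fun i => (u i : complexBetti A.X 1)) :=
      u.linearIndependent.map' (Module.End.eigenspace (complexBetti.map φ.hom.hom.hom 1).hom ρ).subtype
        (Module.End.eigenspace (complexBetti.map φ.hom.hom.hom 1).hom ρ).ker_subtype
    -- `V_ρ(φ)` is disjoint from the span of the earlier blocks (eigenspaces are independent)
    have hspan₀ : Submodule.span ℂ (Set.range w₀) ≤
        ⨆ ρ' ∈ (T : Set ℂ), Module.End.eigenspace (complexBetti.map φ.hom.hom.hom 1).hom ρ' := by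
      rw [Submodule.span_le]
      rintro _ ⟨t, rfl⟩
      obtain ⟨ρ', hρ', ht⟩ := hmem₀ t
      exact Submodule.mem_iSup_of_mem ρ' (Submodule.mem_iSup_of_mem (Finset.mem_coe.2 hρ') ht)
    have hdisj : Disjoint (Submodule.span ℂ (Set.range fun i => (u i : complexBetti A.X 1)))
        (Submodule.span ℂ (Set.range w₀)) := by
      refine Disjoint.mono (Submodule.span_le.2 ?_) hspan₀
        ((Module.End.eigenspaces_iSupIndep (complexBetti.map φ.hom.hom.hom 1).hom).disjoint_biSup
          (show ρ ∉ (T : Set ℂ) from fun h => hρT (Finset.mem_coe.1 h)))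
      rintro _ ⟨i, rfl⟩
      exact hu i
    have hli : LinearIndependent ℂ (Fin.append (fun i => (u i : complexBetti A.X 1)) w₀) := by
      rw [← linearIndependent_equiv finSumFinEquiv]
      have e : Fin.append (fun i => (u i : complexBetti A.X 1)) w₀ ∘
          ⇑(finSumFinEquiv : Fin r ⊕ Fin n₀ ≃ Fin (r + n₀)) =
          Sum.elim (fun i => (u i : complexBetti A.X 1)) w₀ := by
        funext x
        rcases x with i | j
        · simp
        · simp
      rw [e]
      exact hli_u.sum_type hli₀ hdisj
    refine ⟨r + n₀, Fin.append (fun i => (u i : complexBetti A.X 1)) w₀, ?_, hli, fun t => ?_, ?_⟩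
    · rw [Finset.card_insert_of_notMem hρT, hn₀]
      ring
    · refine Fin.addCases (fun i => ?_) (fun j => ?_) t
      · exact ⟨ρ, Finset.mem_insert_self ρ T, by rw [Fin.append_left]; exact hu i⟩
      · obtain ⟨ρ', hρ', hj⟩ := hmem₀ j
        exact ⟨ρ', Finset.mem_insert_of_mem hρ', by rw [Fin.append_right]; exact hj⟩
    · rw [← cupProduct_cupPowOne_cupPowOne]
      exact hM rfl (hline ρ (Finset.mem_insert_self ρ T) (cupPowOne_mem_pullbackEigenclasses_pow φ hu)) hM₀

/-- The `W_F`-line above a root `μ` of `Q`, for a cup-product-closed system `M ∋ 1` containing `W_{F′} ⊗ ℂ`: a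
linearly independent family `w : Fin r′ → H¹` of `φ`-eigenvectors from the fibre above `μ` whose top wedge lies in
`M` and spans `pullbackEigenclasses A ψ r′ ((x + yμ)^{r′})`.
[cite: MoonenZarhin1998WeilClasses, Introduction and Remark (1), last sentence (chunks p0001, p0004)] -/
private theorem exists_generator_mem_of_cupProduct_mem (M : (n : ℕ) → Submodule ℂ (complexBetti A.X n))
    (hM : ∀ {k l n : ℕ} (h : k + l = n) {a : complexBetti A.X k} {b : complexBetti A.X l},
      a ∈ M k → b ∈ M l → cupProduct h a b ∈ M n)
    (h₁ : singularCohomology.one ℂ (Motives.ComplexPoints A.X) ∈ M 0)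
    (hPm : P.Monic) (hPe : P.natDegree = e) (hPirr : Irreducible (P.map (Int.castRingHom ℚ)))
    (hφ : Polynomial.eval₂ (Int.castRingHom (CategoryTheory.End A)) (φ : CategoryTheory.End A) P = 0)
    (her : e * r = 2 * A.dim)
    (hψ : (ψ : CategoryTheory.End A) =
      Polynomial.eval₂ (Int.castRingHom (CategoryTheory.End A)) (φ : CategoryTheory.End A) S)
    (hQm : Q.Monic) (hQe : Q.natDegree = e') (hQirr : Irreducible (Q.map (Int.castRingHom ℚ)))
    (hψQ : Polynomial.eval₂ (Int.castRingHom (CategoryTheory.End A)) (ψ : CategoryTheory.End A) Q = 0)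
    (her' : e' * r' = 2 * A.dim) (hW : weilClassesField A φ P r ≤ M r)
    {μ : ℂ} (hμ : Polynomial.eval₂ (Int.castRingHom ℂ) μ Q = 0) :
    ∃ w : Fin r' → complexBetti A.X 1, LinearIndependent ℂ w ∧
      (∀ t, ∃ ρ : ℂ, Polynomial.eval₂ (Int.castRingHom ℂ) ρ P = 0 ∧ Polynomial.eval₂ (Int.castRingHom ℂ) ρ S = μ ∧
        w t ∈ Module.End.eigenspace (complexBetti.map φ.hom.hom.hom 1).hom ρ) ∧
      cupPowOne ℂ (Motives.ComplexPoints A.X) r' w ∈ M r' ∧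
      pullbackEigenclasses A ψ r' (fun x y => ((x : ℂ) + (y : ℂ) * μ) ^ r') =
        Submodule.span ℂ {cupPowOne ℂ (Motives.ComplexPoints A.X) r' w} := by
  classical
  haveI := finite_complexBetti_abelianVariety A 1
  have hP0 : P ≠ 0 := fun h => hPirr.ne_zero (by rw [h, Polynomial.map_zero])
  -- the fibre above `μ`
  set T : Finset ℂ := (P.map (Int.castRingHom ℂ)).roots.toFinset.filter
    (fun ρ => Polynomial.eval₂ (Int.castRingHom ℂ) ρ S = μ) with hT
  have hmemT : ∀ {ρ : ℂ}, ρ ∈ T ↔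
      Polynomial.eval₂ (Int.castRingHom ℂ) ρ P = 0 ∧ Polynomial.eval₂ (Int.castRingHom ℂ) ρ S = μ := by
    intro ρ
    rw [hT, Finset.mem_filter, mem_roots_toFinset_map_iff hP0]
  obtain ⟨n, w, hn, hli, hmem, hwM⟩ := exists_cupPowOne_mem_of_lines_le (φ := φ) M hM h₁ T
    (fun ρ hρ => finrank_eigenspace_eq_of_root hPm hPe hPirr hφ her (hmemT.1 hρ).1)
    (fun ρ hρ => (pullbackEigenclasses_le_weilClassesField (hmemT.1 hρ).1).trans hW)
  have hcard : T.card * r = r' :=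
    card_fibre_mul_eq_of_eq_eval₂ hPm hPe hPirr hφ her hψ hQm hQe hQirr hψQ her' hμ
  obtain rfl : n = r' := hn.trans hcard
  haveI := finite_complexBetti_abelianVariety A n
  -- the top wedge lies on the `ψ`-line above `μ` and is non-zero
  have hwline : cupPowOne ℂ (Motives.ComplexPoints A.X) n w ∈
      pullbackEigenclasses A ψ n (fun x y => ((x : ℂ) + (y : ℂ) * μ) ^ n) := by
    choose ρ hρ using hmem
    exact cupPowOne_mem_pullbackEigenclasses_pow_of_eq_eval₂ hψ (fun t => (hmemT.1 (hρ t).1).2)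
      (fun t => (hρ t).2)
  have hw0 : cupPowOne ℂ (Motives.ComplexPoints A.X) n w ≠ 0 := cupPowOne_ne_zero_of_linearIndependent A hli
  -- `ψ^*` is semisimple (killed by the separable `Q`), `dim V_μ(ψ) = r′`, so the `ψ`-line has dimension `≤ 1`
  have hssψ : Module.End.IsSemisimple (complexBetti.map ψ.hom.hom.hom 1).hom := by
    have hsepC : (Q.map (Int.castRingHom ℂ)).Separable := by
      rw [map_castRingHom_complex_eq]; exact hQirr.separable.map
    exact Module.End.isSemisimple_of_squarefree_aeval_eq_zero hsepC.squarefree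
      (aeval_hom_complexBetti_map_one_eq_zero hψQ)
  have hle := (finrank_pullbackEigenclasses_pow_le_one (A := A) (φ := ψ) hssψ (N := n) μ
    (finrank_eigenspace_eq_of_root hQm hQe hQirr hψQ her' hμ).le).1
  refine ⟨w, hli, fun t => ?_, hwM, ?_⟩
  · obtain ⟨ρ, hρ, ht⟩ := hmem t
    exact ⟨ρ, (hmemT.1 hρ).1, (hmemT.1 hρ).2, ht⟩
  · refine le_antisymm (fun c hc => ?_) ((Submodule.span_singleton_le_iff_mem _ _).2 hwline)
    have hne : (⟨_, hwline⟩ : ↥(pullbackEigenclasses A ψ n (fun x y => ((x : ℂ) + (y : ℂ) * μ) ^ n))) ≠ 0 :=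
      fun h => hw0 (congrArg Subtype.val h)
    have hpos : 0 < Module.finrank ℂ
        ↥(pullbackEigenclasses A ψ n (fun x y => ((x : ℂ) + (y : ℂ) * μ) ^ n)) :=
      Module.finrank_pos_iff_exists_ne_zero.2 ⟨_, hne⟩
    obtain ⟨t, ht⟩ := (finrank_eq_one_iff_of_nonzero' _ hne).1 (le_antisymm hle hpos) ⟨c, hc⟩
    rw [Submodule.mem_span_singleton]
    exact ⟨t, by simpa using congrArg Subtype.val ht⟩

end Core

/-! ### §1 The `W_F`-line above `μ` is a wedge of `φ`-eigenvectors taken from the fibre above `μ` -/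

section Line

/-- **THE `W_F`-LINE ABOVE `μ` IS THE WEDGE OF THE CONCATENATED EIGENBASES OF THE FIBRE** (Moonen–Zarhin:
`W_F ⊗ ℂ = ⊕_{σ ∈ Σ_F} ⋀^{r_F} V_{ℂ,σ}` and `V_{ℂ,τ} = ⊕_{τ′|τ} V_{ℂ,τ′}`, so `⋀^{r_F} V_{ℂ,τ} = ⊗_{τ′|τ} ⋀^{r_{F′}} V_{ℂ,τ′}`).
For `F = ℚ(ψ) ⊆ F′ = ℚ(φ)` on the carriers (`P(φ) = 0`, `P` monic irreducible of degree `e`, `e·r = 2 dim A`;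
`ψ = S(φ)`, `Q(ψ) = 0`, `Q` monic irreducible of degree `e′`, `e′·r′ = 2 dim A`) and every complex root `μ` of `Q`:
there is a LINEARLY INDEPENDENT family `w : Fin r′ → H¹(A(ℂ); ℂ)` of `φ^*`-eigenvectors whose eigenvalues are roots
of `P` above `μ` (the concatenation of bases of the `V_ρ(φ)`, `S(ρ) = μ`; `|fibre| · r = r′`) with
`pullbackEigenclasses A ψ r′ ((x + yμ)^{r′}) = ℂ · (w₀ ⌣ ⋯ ⌣ w_{r′-1})`.
[cite: MoonenZarhin1998WeilClasses, Introduction and Remark (1), last sentence (chunks p0001, p0004)]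
[cite: Deligne1982HodgeCycles, §4 (4.3)–(4.4) (PDF p. 46)] [cite: LangeBirkenhake1992, Lemma 1.1.17] -/
theorem exists_pullbackEigenclasses_eq_span_cupPowOne_of_eq_eval₂ (hPm : P.Monic) (hPe : P.natDegree = e)
    (hPirr : Irreducible (P.map (Int.castRingHom ℚ)))
    (hφ : Polynomial.eval₂ (Int.castRingHom (CategoryTheory.End A)) (φ : CategoryTheory.End A) P = 0)
    (her : e * r = 2 * A.dim)
    (hψ : (ψ : CategoryTheory.End A) =
      Polynomial.eval₂ (Int.castRingHom (CategoryTheory.End A)) (φ : CategoryTheory.End A) S)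
    (hQm : Q.Monic) (hQe : Q.natDegree = e') (hQirr : Irreducible (Q.map (Int.castRingHom ℚ)))
    (hψQ : Polynomial.eval₂ (Int.castRingHom (CategoryTheory.End A)) (ψ : CategoryTheory.End A) Q = 0)
    (her' : e' * r' = 2 * A.dim) {μ : ℂ} (hμ : Polynomial.eval₂ (Int.castRingHom ℂ) μ Q = 0) :
    ∃ w : Fin r' → complexBetti A.X 1, LinearIndependent ℂ w ∧
      (∀ t, ∃ ρ : ℂ, Polynomial.eval₂ (Int.castRingHom ℂ) ρ P = 0 ∧ Polynomial.eval₂ (Int.castRingHom ℂ) ρ S = μ ∧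
        w t ∈ Module.End.eigenspace (complexBetti.map φ.hom.hom.hom 1).hom ρ) ∧
      pullbackEigenclasses A ψ r' (fun x y => ((x : ℂ) + (y : ℂ) * μ) ^ r') =
        Submodule.span ℂ {cupPowOne ℂ (Motives.ComplexPoints A.X) r' w} := by
  obtain ⟨w, hli, hmem, -, hline⟩ := exists_generator_mem_of_cupProduct_mem (fun n => (⊤ : Submodule ℂ (complexBetti A.X n)))
    (fun _ _ _ _ _ => Submodule.mem_top) Submodule.mem_top hPm hPe hPirr hφ her hψ hQm hQe hQirr hψQ her'
    le_top hμ
  exact ⟨w, hli, hmem, hline⟩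

end Line

/-! ### §2 `W_F ⊗ ℂ` lies in every cup-product-closed system of classes containing `W_{F′} ⊗ ℂ` -/

section Subalgebra

/-- **MOONEN–ZARHIN 1998, Remark (1), last sentence — «`W_F` is contained in the vector subspace generated by
exterior products of elements of `W_{F′}`» — FOR A SUBFIELD `F ⊆ F′` OF ANY INDEX, on the carriers.**  Let
`M n ⊆ Hⁿ(A(ℂ); ℂ)` (`n ∈ ℕ`) be subspaces closed under cup products (`a ∈ M k`, `b ∈ M l` ⟹ `a ⌣ b ∈ M (k + l)`) with
`1 ∈ M 0`.  For `F′ = ℚ(φ)` (`P(φ) = 0`, `P ∈ ℤ[T]` monic irreducible of degree `e`, `e·r = 2 dim A`) and the subfield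
`F = ℚ(ψ)`, `ψ = S(φ)` (`Q(ψ) = 0`, `Q ∈ ℤ[T]` monic irreducible of degree `e′`, `e′·r′ = 2 dim A`):
`weilClassesField A φ P r ⊆ M r ⟹ weilClassesField A ψ Q r′ ⊆ M r′` — the `W_F`-line above each root `μ` of `Q` is
the cup product of the top wedges of the `[F′:F] = r′/r` blocks `V_ρ(φ)`, `S(ρ) = μ`, each of which generates a
`W_{F′}`-line (§1). [cite: MoonenZarhin1998WeilClasses, Remark (1), last sentence (chunk p0004)]
[cite: Deligne1982HodgeCycles, §4 (4.4) (PDF p. 46)] [cite: HatcherAT2002, §3.2 Prop. 3.10] -/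
theorem weilClassesField_le_of_cupProduct_mem_of_eq_eval₂ (M : (n : ℕ) → Submodule ℂ (complexBetti A.X n))
    (hM : ∀ {k l n : ℕ} (h : k + l = n) {a : complexBetti A.X k} {b : complexBetti A.X l},
      a ∈ M k → b ∈ M l → cupProduct h a b ∈ M n)
    (h₁ : singularCohomology.one ℂ (Motives.ComplexPoints A.X) ∈ M 0)
    (hPm : P.Monic) (hPe : P.natDegree = e) (hPirr : Irreducible (P.map (Int.castRingHom ℚ)))
    (hφ : Polynomial.eval₂ (Int.castRingHom (CategoryTheory.End A)) (φ : CategoryTheory.End A) P = 0)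
    (her : e * r = 2 * A.dim)
    (hψ : (ψ : CategoryTheory.End A) =
      Polynomial.eval₂ (Int.castRingHom (CategoryTheory.End A)) (φ : CategoryTheory.End A) S)
    (hQm : Q.Monic) (hQe : Q.natDegree = e') (hQirr : Irreducible (Q.map (Int.castRingHom ℚ)))
    (hψQ : Polynomial.eval₂ (Int.castRingHom (CategoryTheory.End A)) (ψ : CategoryTheory.End A) Q = 0)
    (her' : e' * r' = 2 * A.dim) (hW : weilClassesField A φ P r ≤ M r) :
    weilClassesField A ψ Q r' ≤ M r' := by
  refine iSup₂_le fun μ hμ => ?_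
  obtain ⟨w, -, -, hwM, hline⟩ := exists_generator_mem_of_cupProduct_mem M hM h₁ hPm hPe hPirr hφ her hψ hQm hQe
    hQirr hψQ her' hW hμ
  rw [hline]
  exact (Submodule.span_singleton_le_iff_mem _ _).2 hwM

end Subalgebra

/-! ### §3 The even-degree form: systems `N j ⊆ H^{2j}` closed under cup products (the shape of `algebraicClasses`) -/

section Even

/-- **Moonen–Zarhin's Remark (1) for any index, even-degree systems.**  Let `N j ⊆ H^{2j}(A(ℂ); ℂ)` (`j ∈ ℕ`) be
subspaces closed under cup products (`a ∈ N i`, `b ∈ N j` ⟹ `a ⌣ b ∈ N (i + j)`, in the typing of the tree's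
`AbelianVariety.cupProduct_mem_algebraicClasses'`) with `N 0 = H⁰`.  For `F = ℚ(S(φ)) ⊆ F′ = ℚ(φ)` as in §2 with
`e · 2m = 2 dim A`, `e′ · 2m′ = 2 dim A`: `weilClassesField A φ P (2m) ⊆ N m ⟹ weilClassesField A ψ Q (2m′) ⊆ N m′`
(§2 for the system equal to `N j` in degree `2j` and to `0` in odd degrees — closed under cup products because a
product landing in even degree has both factors of even degree or one of them zero).
[cite: MoonenZarhin1998WeilClasses, Remark (1), last sentence (chunk p0004)] [cite: HatcherAT2002, §3.2 Prop. 3.10] -/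
theorem weilClassesField_le_of_cupProduct_mem_even_of_eq_eval₂ {m m' : ℕ}
    (N : (j : ℕ) → Submodule ℂ (complexBetti A.X (2 * j)))
    (hN : ∀ {i j p : ℕ} (h : 2 * i + 2 * j = 2 * p) {a : complexBetti A.X (2 * i)} {b : complexBetti A.X (2 * j)},
      a ∈ N i → b ∈ N j → cupProduct h a b ∈ N p)
    (hN₀ : N 0 = ⊤)
    (hPm : P.Monic) (hPe : P.natDegree = e) (hPirr : Irreducible (P.map (Int.castRingHom ℚ)))
    (hφ : Polynomial.eval₂ (Int.castRingHom (CategoryTheory.End A)) (φ : CategoryTheory.End A) P = 0)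
    (her : e * (2 * m) = 2 * A.dim)
    (hψ : (ψ : CategoryTheory.End A) =
      Polynomial.eval₂ (Int.castRingHom (CategoryTheory.End A)) (φ : CategoryTheory.End A) S)
    (hQm : Q.Monic) (hQe : Q.natDegree = e') (hQirr : Irreducible (Q.map (Int.castRingHom ℚ)))
    (hψQ : Polynomial.eval₂ (Int.castRingHom (CategoryTheory.End A)) (ψ : CategoryTheory.End A) Q = 0)
    (her' : e' * (2 * m') = 2 * A.dim) (hW : weilClassesField A φ P (2 * m) ≤ N m) :
    weilClassesField A ψ Q (2 * m') ≤ N m' := by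
  classical
  -- the all-degree system: `N j` in degree `2j`, `0` in odd degrees
  let M : (n : ℕ) → Submodule ℂ (complexBetti A.X n) := fun n =>
    { carrier := {c | (¬ Even n → c = 0) ∧ ∀ (j : ℕ) (h : n = 2 * j), (h ▸ c) ∈ N j}
      add_mem' := fun {a b} ha hb =>
        ⟨fun hn => by rw [ha.1 hn, hb.1 hn, add_zero], fun j h => by
          subst h
          exact (N j).add_mem (ha.2 j rfl) (hb.2 j rfl)⟩
      zero_mem' := ⟨fun _ => rfl, fun j h => by
          subst h
          exact (N j).zero_mem⟩
      smul_mem' := fun t {c} hc =>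
        ⟨fun hn => by rw [hc.1 hn, smul_zero], fun j h => by
          subst h
          exact (N j).smul_mem t (hc.2 j rfl)⟩ }
  have hmemM : ∀ {n : ℕ} {c : complexBetti A.X n},
      c ∈ M n ↔ (¬ Even n → c = 0) ∧ ∀ (j : ℕ) (h : n = 2 * j), (h ▸ c) ∈ N j := fun {n c} => Iff.rfl
  have hM : ∀ {k l n : ℕ} (h : k + l = n) {a : complexBetti A.X k} {b : complexBetti A.X l},
      a ∈ M k → b ∈ M l → cupProduct h a b ∈ M n := by
    intro k l n h a b ha hb
    rw [hmemM] at ha hb ⊢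
    refine ⟨fun hn => ?_, fun j hj => ?_⟩
    · by_cases hk : Even k
      · have hl : ¬ Even l := fun hl => hn (h ▸ hk.add hl)
        rw [hb.1 hl, map_zero]
      · rw [ha.1 hk, LinearMap.map_zero₂]
    · subst hj
      by_cases hk : Even k
      · obtain ⟨k', rfl⟩ := even_iff_two_dvd.mp hk
        obtain ⟨l', rfl⟩ : ∃ l', l = 2 * l' := ⟨j - k', by omega⟩
        exact hN h (ha.2 k' rfl) (hb.2 l' rfl)
      · show cupProduct h a b ∈ N j
        rw [ha.1 hk, LinearMap.map_zero₂]
        exact (N j).zero_mem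
  have h₁ : singularCohomology.one ℂ (Motives.ComplexPoints A.X) ∈ M 0 := by
    rw [hmemM]
    refine ⟨fun h0 => absurd (Even.zero : Even 0) h0, fun j hj => ?_⟩
    obtain rfl : j = 0 := by omega
    rw [hN₀]
    exact Submodule.mem_top
  have hWM : weilClassesField A φ P (2 * m) ≤ M (2 * m) := fun c hc => by
    rw [hmemM]
    refine ⟨fun hodd => absurd (even_two_mul m) hodd, fun j hj => ?_⟩
    obtain rfl : j = m := by omega
    exact hW hc
  intro c hc
  exact ((hmemM.1 (weilClassesField_le_of_cupProduct_mem_of_eq_eval₂ M hM h₁ hPm hPe hPirr hφ her hψ hQm hQe hQirr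
    hψQ her' hWM hc)).2 m' rfl)

end Even

/-! ### §4 Algebraicity of the Weil classes descends to every subfield -/

section Algebraic

/-- **`W_{F′} ⊗ ℂ` ALGEBRAIC ⟹ `W_F ⊗ ℂ` ALGEBRAIC, FOR A SUBFIELD `F ⊆ F′ ⊂ End⁰(A)` OF ANY INDEX** (Moonen–Zarhin's
Remark (1) with the algebra of algebraic classes in place of `D`): for `F′ = ℚ(φ)` (`P(φ) = 0`, `P ∈ ℤ[T]` monic
irreducible of degree `e`, `e · 2m = 2 dim A`) and `F = ℚ(ψ)`, `ψ = S(φ)` (`Q(ψ) = 0`, `Q ∈ ℤ[T]` monic irreducible of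
degree `e′`, `e′ · 2m′ = 2 dim A`), if `weilClassesField A φ P (2m) ⊆ algebraicClasses A.X m` then
`weilClassesField A ψ Q (2m′) ⊆ algebraicClasses A.X m′` — §3 for `N = algebraicClasses A.X`, closed under cup products
on an abelian variety (Voisin II Prop. 9.20, `AbelianVariety.cupProduct_mem_algebraicClasses'`) with
`algebraicClasses A.X 0 = H⁰`. [cite: MoonenZarhin1998WeilClasses, Remark (1) (chunk p0004)]
[cite: VoisinHodgeII2003, Prop. 9.20] -/
theorem weilClassesField_le_algebraicClasses_of_eq_eval₂_of_irreducible {m m' : ℕ} (hPm : P.Monic)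
    (hPe : P.natDegree = e) (hPirr : Irreducible (P.map (Int.castRingHom ℚ)))
    (hφ : Polynomial.eval₂ (Int.castRingHom (CategoryTheory.End A)) (φ : CategoryTheory.End A) P = 0)
    (her : e * (2 * m) = 2 * A.dim)
    (hψ : (ψ : CategoryTheory.End A) =
      Polynomial.eval₂ (Int.castRingHom (CategoryTheory.End A)) (φ : CategoryTheory.End A) S)
    (hQm : Q.Monic) (hQe : Q.natDegree = e') (hQirr : Irreducible (Q.map (Int.castRingHom ℚ)))
    (hψQ : Polynomial.eval₂ (Int.castRingHom (CategoryTheory.End A)) (ψ : CategoryTheory.End A) Q = 0)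
    (her' : e' * (2 * m') = 2 * A.dim) (hW : weilClassesField A φ P (2 * m) ≤ algebraicClasses A.X m) :
    weilClassesField A ψ Q (2 * m') ≤ algebraicClasses A.X m' :=
  weilClassesField_le_of_cupProduct_mem_even_of_eq_eval₂ (fun j => algebraicClasses A.X j)
    (fun h _ _ ha hb => AbelianVariety.cupProduct_mem_algebraicClasses' A h ha hb) algebraicClasses_zero
    hPm hPe hPirr hφ her hψ hQm hQe hQirr hψQ her' hW

/-- **One non-zero rational algebraic Weil class for `F′` makes the Weil classes of EVERY subfield `F = ℚ(S(φ))`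
algebraic**: by the one-class lemma (`weilClassesField_le_algebraicClasses_of_isRationalClass_of_ne_zero` — the
`F′`-line `W_{F′}` is spanned over `F′ ⊂ End⁰(A)`, acting by algebraic correspondences, by any non-zero rational class;
Moonen–Zarhin «`dim_F W_F = 1`», Markman §4) all of `W_{F′} ⊗ ℂ` is algebraic (`m > 0`), and this descends to `F` by
`weilClassesField_le_algebraicClasses_of_eq_eval₂_of_irreducible`.
[cite: MoonenZarhin1998WeilClasses, §1 (dim_F W_F = 1) and Remark (1) (chunks p0001, p0004)]
[cite: Markman2025SurveySecant, §4] [cite: VoisinHodgeII2003, Prop. 9.20] -/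
theorem weilClassesField_le_algebraicClasses_of_isRationalClass_of_irreducible {m m' : ℕ} (hPm : P.Monic)
    (hPe : P.natDegree = e) (hPirr : Irreducible (P.map (Int.castRingHom ℚ)))
    (hφ : Polynomial.eval₂ (Int.castRingHom (CategoryTheory.End A)) (φ : CategoryTheory.End A) P = 0)
    (her : e * (2 * m) = 2 * A.dim) (hm : 0 < m)
    (hψ : (ψ : CategoryTheory.End A) =
      Polynomial.eval₂ (Int.castRingHom (CategoryTheory.End A)) (φ : CategoryTheory.End A) S)
    (hQm : Q.Monic) (hQe : Q.natDegree = e') (hQirr : Irreducible (Q.map (Int.castRingHom ℚ)))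
    (hψQ : Polynomial.eval₂ (Int.castRingHom (CategoryTheory.End A)) (ψ : CategoryTheory.End A) Q = 0)
    (her' : e' * (2 * m') = 2 * A.dim)
    {γ : complexBetti A.X (2 * m)} (hγW : γ ∈ weilClassesField A φ P (2 * m)) (hγQ : IsRationalClass γ)
    (hγ0 : γ ≠ 0) (hγalg : γ ∈ algebraicClasses A.X m) :
    weilClassesField A ψ Q (2 * m') ≤ algebraicClasses A.X m' :=
  weilClassesField_le_algebraicClasses_of_eq_eval₂_of_irreducible hPm hPe hPirr hφ her hψ hQm hQe hQirr hψQ her'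
    (weilClassesField_le_algebraicClasses_of_isRationalClass_of_ne_zero hPe hPirr hφ her hm hγW hγQ hγ0 hγalg)

/-- **Deligne's Weil-type CM data and an arbitrary subfield `ℚ(S(η)) ⊆ E = ℚ(η)`**: for
`Deligne1982.IsWeilTypeCM A η R e₀ k` (`E ≅ ℚ[T]/(R(T²))` a CM field of degree `2e₀`, `dim A = 2k·e₀`,
`W_E ⊗ ℂ = weilClassesField A η (R(T²)) (2k)`) and `ψ = S(η)` with `Q(ψ) = 0`, `Q ∈ ℤ[T]` monic irreducible of degree
`e′`, `e′ · 2m′ = 2 dim A`: if `W_E ⊗ ℂ` consists of algebraic classes, so does `W_{ℚ(ψ)} ⊗ ℂ = weilClassesField A ψ Q (2m′)`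
(the case `S = T²`, `ℚ(ψ) = E₀` the maximal totally real subfield, is `weilClassesField_sq_le_algebraicClasses_of_isWeilTypeCM`).
[cite: MoonenZarhin1998WeilClasses, Remark (1) (chunk p0004)] [cite: Deligne1982HodgeCycles, §4 (4.4), §5 Prop. 5.1]
[cite: VoisinHodgeII2003, Prop. 9.20] -/
theorem weilClassesField_le_algebraicClasses_of_isWeilTypeCM_of_eq_eval₂ {η : A ⟶ A} {R : Polynomial ℤ}
    {e₀ k m' : ℕ} (hWT : Deligne1982.IsWeilTypeCM A η R e₀ k)
    (hψ : (ψ : CategoryTheory.End A) =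
      Polynomial.eval₂ (Int.castRingHom (CategoryTheory.End A)) (η : CategoryTheory.End A) S)
    (hQm : Q.Monic) (hQe : Q.natDegree = e') (hQirr : Irreducible (Q.map (Int.castRingHom ℚ)))
    (hψQ : Polynomial.eval₂ (Int.castRingHom (CategoryTheory.End A)) (ψ : CategoryTheory.End A) Q = 0)
    (her' : e' * (2 * m') = 2 * A.dim)
    (hWalg : weilClassesField A η (R.comp (Polynomial.X ^ 2)) (2 * k) ≤ algebraicClasses A.X k) :
    weilClassesField A ψ Q (2 * m') ≤ algebraicClasses A.X m' :=
  weilClassesField_le_algebraicClasses_of_eq_eval₂_of_irreducible hWT.monic_comp hWT.natDegree_comp hWT.irreducible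
    hWT.eval₂_eq_zero hWT.degree_mul_rank hψ hQm hQe hQirr hψQ her' hWalg

end Algebraic

end HodgeTheory

end Literature.AlgebraicGeometry.HodgeTheory
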